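import Literature.NumberTheory.Automorphic.SpreadPairDatumNeConj
import HarnessLib

/-!
# The spread pair datum for two cuspidal representations with a COMMON FIXING test function, and the
# self-pair case (Corollaire (ii) of Mœglin–Waldspurger)

Topic `NumberTheory/Automorphic`; namespace `Literature.NumberTheory.Automorphic`. Theorems only.
`exists_spreadPairDatum_neConj` (`SpreadPairDatumNeConj`) realises an archimedean datum `(e, e')` of a
PAIR of ORTHOGONAL cuspidal automorphic representations `π ⟂ σ̄` of `GL_{n+1}(𝔸_K)` globally, at a level
supported on a PRESCRIBED finite set `S` of finite places, by a spread intertwiner `T_sp` of `π`, the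
given intertwiner `T₁'` of `σ̄` and ONE common fixing test function `η` — the input of the bad-place
treatment of the Rankin–Selberg method for `L^S(s, π × σ)` (Jacquet–Piatetski-Shapiro–Shalika (1983),
(2.7); Cogdell (2004), §4.1). Orthogonality enters that proof at exactly one point: the existence of the
common fixing test function (`exists_testFunctionGL_smoothedVector_eq_pair`). Here the same construction
is run with that step abstracted into a hypothesis (`exists_spreadPairDatum_of_commonFixing`), and
specialised to the SELF-PAIR case `σ̄ = π` (`exists_spreadPairDatum_self`), where the common fixing test
function is `exists_testFunction_smoothedVector_eq_pairSame` (Harish-Chandra's finiteness theorem inside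
ONE cuspidal representation). The self-pair datum at a prescribed `S` is the input of Mœglin–Waldspurger's
Corollaire (ii) (`s (s - 1) L^S(s, π × π̃)` entire) for all `S` (`PairLFunctionEqConjOfArchAllPairs`);
`exists_spreadPairDatum` (`SpreadPairDatum`) is the same datum at a level of its own choosing.

## References

* C. Mœglin, J.-L. Waldspurger, *Le spectre résiduel de GL(n)*, Ann. Sci. ÉNS 22 (1989), Appendice,
  Corollaire (ii), p. 667 [MoeglinWaldspurger1989].
* H. Jacquet, I. I. Piatetski-Shapiro, J. A. Shalika, *Rankin–Selberg convolutions*, Amer. J. Math.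
  105 (1983), §2, (2.7) [JacquetPiatetskiShapiroShalika1983].
* J. W. Cogdell, *Analytic theory of L-functions for GL_n* (2004), §1.2, §4.1 [CogdellAnalyticTheory2004].
-/

noncomputable section

open MeasureTheory Measure NumberField NumberField.mixedEmbedding IsDedekindDomain Matrix WithZero Set Filter
open scoped MatrixGroups ComplexConjugate Topology NNReal Classical
open Literature.NumberTheory.Automorphic.WhittakerSupport

namespace Literature.NumberTheory.Automorphic

section Datum

variable {n : ℕ} {K : Type} [Field K] [NumberField K]
variable {μ : Measure (AdelicGroupData.gl (n + 1) K).automorphicQuotient} [(AdelicGroupData.gl (n + 1) K).IsAutomorphicMeasure μ]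

-- the house Borel structures, as in `SpreadIntertwiner`
attribute [local instance] adelicBorel borelSpace_adelic locallyCompactSpace_adelic secondCountableTopology_gl_adelic
  glAdeleBorel borelSpace_glAdele
attribute [local instance] glLocalBorel borelSpace_glLocal

variable {hcpt : isCompact_glFiniteIntegralLevel (n + 1) K}
  {E : Type*} [NormedAddCommGroup E] [InnerProductSpace ℂ E] [CompleteSpace E]
  {τ : ContRepresentation ℂ (AutomorphyDatum.gl (n + 1) K hcpt).arch.carrier E}
  {E' : Type*} [NormedAddCommGroup E'] [InnerProductSpace ℂ E'] [CompleteSpace E']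
  {τ' : ContRepresentation ℂ (AutomorphyDatum.gl (n + 1) K hcpt).arch.carrier E'}

set_option maxHeartbeats 3200000 in
set_option synthInstance.maxHeartbeats 200000 in
set_option backward.isDefEq.respectTransparency false in
/-- **The spread pair datum for two representations with a common fixing test function.** Let `π`, `σ'`
be cuspidal automorphic representations of `GL_{n+1}(𝔸_K)` (in the same `L²_cusp`) such that ANY two
`K_∞`-finite cusp forms `u ∈ π`, `u' ∈ σ'` of a common finite level `U` are fixed by ONE left
`U`-invariant test function (hypothesis `hcf`: for `π ⟂ σ'` this is
`exists_testFunctionGL_smoothedVector_eq_pair`, for `σ' = π` it is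
`exists_testFunction_smoothedVector_eq_pairSame`), with archimedean components `τ` (strongly continuous),
`τ'`, `ν₀` a Haar measure on `N(𝔸_K)`, `(T₀, Λ₀)` a line datum of the finite Whittaker model of `π`, `S` a
finite set of finite places, `T₁ : τ → π` of level `K_f(𝔫₁)` and `T₁' : τ' → σ'` of level `K_f(𝔫₁')` with
the prime divisors of `𝔫₁`, `𝔫₁'` in `S`, `D_f ∈ GL_{n+1}(𝔸_K^∞)` trivial at the places of `S` and integral
outside a finite `S⁺`, and `e`, `e'` `K_∞`-finite Gårding vectors of `τ`, `τ'`. Then there are a depth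
`m ≥ 1`, an ideal `𝔫 ≠ 0` with prime factors in `S` and `|𝔫|_v ≤ q_v^{-m}` for `v ∈ S`, the spread
intertwiner `T_sp` of `π` of level `K_f(𝔫)` with `Λ₀(D_f · T_sp) = Λ₀(D_f · T₁)`, torus parameters `t_v`,
level exponents `M_v` and conductor exponents `c_v` with the inequalities of the support theorem, such
that `T_sp` is `(H_v, χ_v)`-isotypic and `T₁'` is fixed by `ι_v(K(𝔭_v^{M_v}))` for `v ∈ S`, `T₁'` has
level `K_f(𝔫)`, and ONE test function `η`, left `K(𝔫)`-invariant, fixes both `T_sp e` and `T₁' e'`; the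
Whittaker coefficient of `T_sp e` is spread bi-equivariant at every `v ∈ S`. The proof is that of
`exists_spreadPairDatum_neConj` verbatim, with the common fixing test function taken from `hcf`.
[cite: JacquetPiatetskiShapiroShalika1983, §2 (2.7)] [cite: CogdellAnalyticTheory2004, §4.1] -/
theorem exists_spreadPairDatum_of_commonFixing (P Q : CuspidalAutomorphicRepGL (n + 1) K μ)
    (hcf : ∀ {U : Subgroup (AdelicGroupData.gl (n + 1) K).Adelic}, U ∈ (AutomorphyDatum.gl (n + 1) K hcpt).finiteLevels →
      ∀ (u : P.1.toSubmodule) (u' : Q.1.toSubmodule),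
        FiniteDimensional ℂ (Submodule.span ℂ (Set.range
          fun k : (AutomorphyDatum.gl (n + 1) K hcpt).arch.maximalCompact =>
            P.1.toContRep ((AutomorphyDatum.gl (n + 1) K hcpt).ofK k) u)) →
        FiniteDimensional ℂ (Submodule.span ℂ (Set.range
          fun k : (AutomorphyDatum.gl (n + 1) K hcpt).arch.maximalCompact =>
            Q.1.toContRep ((AutomorphyDatum.gl (n + 1) K hcpt).ofK k) u')) →
        (∀ g ∈ U, P.1.toContRep g u = u) → (∀ g ∈ U, Q.1.toContRep g u' = u') →
        ∃ η : (AdelicGroupData.gl (n + 1) K).Adelic → ℝ, IsTestFunctionGL (n + 1) K η ∧ (∀ k ∈ U, ∀ g, η (k * g) = η g) ∧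
          smoothedVector P.1 η u = u ∧ smoothedVector Q.1 η u' = u')
    (hτ : τ.IsStronglyContinuous)
    (ν₀ : Measure ↥(adelicUnipotent (n + 1) K)) [IsHaarMeasure ν₀]
    {T₀ : multiplicityModule hcpt τ P.1} {Λ₀ : multiplicityModule hcpt τ P.1 →ₗ[ℂ] ℂ}
    (hne : transferMap (whittakerFunctional ν₀ (continuous_adeleAddChar K)
      (ContRepresentation.Equiv.refl P.1.toContRep)) hτ T₀ ≠ 0)
    (hΛ : ∀ T : multiplicityModule hcpt τ P.1,
      transferMap (whittakerFunctional ν₀ (continuous_adeleAddChar K)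
        (ContRepresentation.Equiv.refl P.1.toContRep)) hτ T =
        Λ₀ T • transferMap (whittakerFunctional ν₀ (continuous_adeleAddChar K)
          (ContRepresentation.Equiv.refl P.1.toContRep)) hτ T₀)
    (S : Finset (HeightOneSpectrum (𝓞 K)))
    {𝔫₁ : Ideal (𝓞 K)} (h𝔫₁ : 𝔫₁ ≠ 0) (hS𝔫₁ : ∀ v : HeightOneSpectrum (𝓞 K), v.asIdeal ∣ 𝔫₁ → v ∈ S)
    (T₁ : multiplicityModule hcpt τ P.1)
    (hT₁ : (T₁ : E →L[ℂ] (AdelicGroupData.gl (n + 1) K).L2 μ) ∈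
      archIntertwinersLevel hcpt τ P.1 (finitePrincipalCongruenceLevel (n + 1) K 𝔫₁))
    {𝔫₁' : Ideal (𝓞 K)} (h𝔫₁' : 𝔫₁' ≠ 0) (hS𝔫₁' : ∀ v : HeightOneSpectrum (𝓞 K), v.asIdeal ∣ 𝔫₁' → v ∈ S)
    (T₁' : multiplicityModule hcpt τ' Q.1)
    (hT₁' : (T₁' : E' →L[ℂ] (AdelicGroupData.gl (n + 1) K).L2 μ) ∈
      archIntertwinersLevel hcpt τ' Q.1 (finitePrincipalCongruenceLevel (n + 1) K 𝔫₁'))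
    (Df : GL (Fin (n + 1)) (FiniteAdeleRing (𝓞 K) K))
    (hDfS : ∀ v ∈ S, BigHeckeGLn.localComponent (n + 1) K v Df = 1)
    (Splus : Finset (HeightOneSpectrum (𝓞 K)))
    (hDfint : ∀ w ∉ Splus, BigHeckeGLn.localComponent (n + 1) K w Df ∈ valuedCongruenceSubgroup (Fin (n + 1)) (1 : ℤᵐ⁰))
    (e : archGardingSpace hcpt τ) (e' : archGardingSpace hcpt τ')
    (hefin : FiniteDimensional ℂ (Submodule.span ℂ (Set.range
      fun κ : (AutomorphyDatum.gl (n + 1) K hcpt).arch.maximalCompact =>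
        τ (toArch hcpt (κ : GL (Fin (n + 1)) (mixedSpace K))) (e : E))))
    (he'fin : FiniteDimensional ℂ (Submodule.span ℂ (Set.range
      fun κ : (AutomorphyDatum.gl (n + 1) K hcpt).arch.maximalCompact =>
        τ' (toArch hcpt (κ : GL (Fin (n + 1)) (mixedSpace K))) (e' : E')))) :
    ∃ (m : ℕ) (𝔫 : Ideal (𝓞 K)) (_ : 𝔫 ≠ 0) (_ : ∀ v : HeightOneSpectrum (𝓞 K), v.asIdeal ∣ 𝔫 → v ∈ S)
      (Tsp : multiplicityModule hcpt τ P.1) (η : GL (Fin (n + 1)) (AdeleRing (𝓞 K) K) → ℝ)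
      (t : ∀ v : HeightOneSpectrum (𝓞 K), Fin (n + 1) → (v.adicCompletion K)ˣ) (M c₀ : HeightOneSpectrum (𝓞 K) → ℤ),
      IsTestFunctionGL (n + 1) K η ∧
      (∀ k : (AdelicGroupData.gl (n + 1) K).Adelic, k ∈ principalCongruenceLevel (n + 1) K 𝔫 →
        ∀ g : (AdelicGroupData.gl (n + 1) K).Adelic, η (k * g) = η g) ∧
      1 ≤ m ∧ (∀ v ∈ S, idealRadius K v 𝔫 ≤ exp (-(m : ℤ))) ∧
      Λ₀ (finComponentRep hcpt τ P.1 Df Tsp) = Λ₀ (finComponentRep hcpt τ P.1 Df T₁) ∧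
      (Tsp : E →L[ℂ] (AdelicGroupData.gl (n + 1) K).L2 μ) ∈
        archIntertwinersLevel hcpt τ P.1 (finitePrincipalCongruenceLevel (n + 1) K 𝔫) ∧
      (T₁' : E' →L[ℂ] (AdelicGroupData.gl (n + 1) K).L2 μ) ∈
        archIntertwinersLevel hcpt τ' Q.1 (finitePrincipalCongruenceLevel (n + 1) K 𝔫) ∧
      smoothedVector P.1 η ⟨(Tsp : E →L[ℂ] (AdelicGroupData.gl (n + 1) K).L2 μ) (e : E),
          apply_mem_of_mem_multiplicityModule Tsp e⟩ =
        ⟨(Tsp : E →L[ℂ] (AdelicGroupData.gl (n + 1) K).L2 μ) (e : E), apply_mem_of_mem_multiplicityModule Tsp e⟩ ∧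
      smoothedVector Q.1 η ⟨(T₁' : E' →L[ℂ] (AdelicGroupData.gl (n + 1) K).L2 μ) (e' : E'),
          apply_mem_of_mem_multiplicityModule T₁' e'⟩ =
        ⟨(T₁' : E' →L[ℂ] (AdelicGroupData.gl (n + 1) K).L2 μ) (e' : E'), apply_mem_of_mem_multiplicityModule T₁' e'⟩ ∧
      (∀ v ∈ S, ∀ h ∈ spreadLevelGroup (t v) (M v),
        finComponentRep hcpt τ P.1 (GLn.sndHom (n + 1) K (GLn.ofLocal (n + 1) K v h)) Tsp = spreadChar v h • Tsp) ∧
      (∀ v ∈ S, ∀ k ∈ valuedCongruenceSubgroup (Fin (n + 1)) (exp (-M v)),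
        finComponentRep hcpt τ' Q.1 (GLn.sndHom (n + 1) K (GLn.ofLocal (n + 1) K v k)) T₁' = T₁') ∧
      (∀ v ∈ S, (∃ x : v.adicCompletion K, Valued.v x ≤ exp (1 - c₀ v) ∧ (adeleAddChar K).adicComponent v x ≠ 1) ∧
        1 ≤ M v ∧
        (∀ i j : Fin (n + 1), (i : ℕ) + 1 = j → ∀ x : v.adicCompletion K, Valued.v x ≤ exp (-M v) →
          (adeleAddChar K).adicComponent v ((t v i : v.adicCompletion K) * (t v j : v.adicCompletion K)⁻¹ * x) = 1) ∧
        (∀ i j : Fin (n + 1), i ≤ j → Valued.v (t v j : v.adicCompletion K) ≤ Valued.v (t v i : v.adicCompletion K)) ∧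
        (∀ i j : Fin (n + 1), (i : ℕ) + 1 = j →
          exp (M v - c₀ v) * Valued.v (t v j : v.adicCompletion K) ≤ Valued.v (t v i : v.adicCompletion K)) ∧
        exp (-(m : ℤ)) * Valued.v (t v 0 : v.adicCompletion K) ≤
          exp (-M v) * Valued.v (t v (Fin.last n) : v.adicCompletion K)) ∧
      ∀ v ∈ S, IsSpreadWhittakerAt v (adeleAddChar K) (t v) (M v)
        (whittakerCoeff ν₀ (unipotentTateDomain (n + 1) K) (adeleAddChar K)
          (invQuot (AdelicGroupData.gl (n + 1) K)
            (smoothedForm η ((Tsp : E →L[ℂ] (AdelicGroupData.gl (n + 1) K).L2 μ) (e : E))))) := by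
  classical
  -- (0) the level of `D_f · T₁`
  obtain ⟨r, hDT₁lev⟩ := exists_finComponentRep_mem_archIntertwinersLevel Splus h𝔫₁ T₁ hT₁ Df hDfint
  set 𝔫₁p : Ideal (𝓞 K) := spreadLevelIdeal 𝔫₁ r Splus.toList with h𝔫₁p
  have h𝔫₁p0 : 𝔫₁p ≠ 0 := spreadLevelIdeal_ne_zero h𝔫₁ r _
  have h𝔫₁p𝔫₁ : ∀ v, idealRadius K v 𝔫₁p ≤ idealRadius K v 𝔫₁ := fun v => idealRadius_spreadLevelIdeal_le h𝔫₁ r _ v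
  -- (1) per-place data
  have hcond : ∀ v : HeightOneSpectrum (𝓞 K), ∃ d : ℤ, ((adeleAddChar K).adicComponent v).HasConductorExp d := fun v =>
    ((isGlobalAddChar_adeleAddChar (K := K)).isContinuousNontrivial_adicComponent
      (adicComponent_adeleAddChar_ne_one v)).exists_hasConductorExp
  choose c hc using hcond
  obtain ⟨ϖ, hϖ⟩ := exists_uniformizers (K := K)
  set A : Ideal (𝓞 K) := 𝔫₁p * 𝔫₁' with hAdef
  have hA0 : A ≠ 0 := mul_ne_zero h𝔫₁p0 h𝔫₁'
  set cnt : HeightOneSpectrum (𝓞 K) → ℕ := fun v => (Associates.mk v.asIdeal).count (Associates.mk A).factors with hcnt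
  set eL : HeightOneSpectrum (𝓞 K) → ℤ := fun v => max (max (c v) 0) (cnt v : ℤ) with heL
  have hH : ∀ v, SpreadHyp (K := K) c eL ϖ v := fun v =>
    { cond := fun y hy => (hc v).1 y ((mem_primePowBall_adicCompletion_iff (v := v)).2 hy)
      e_nonneg := le_trans (le_max_right _ _) (le_max_left _ _)
      c_le_e := le_trans (le_max_left _ _) (le_max_left _ _)
      unif := hϖ v }
  have hradA : ∀ v, exp (-eL v) ≤ idealRadius K v A := fun v => by
    rw [idealRadius_eq_exp_neg_natCast v hA0, exp_le_exp, neg_le_neg_iff]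
    exact le_max_right _ _
  have hradp : ∀ v, exp (-eL v) ≤ idealRadius K v 𝔫₁p := fun v =>
    (hradA v).trans (idealRadius_mul_le_left v h𝔫₁p0 h𝔫₁')
  have hrad₁ : ∀ v, exp (-eL v) ≤ idealRadius K v 𝔫₁ := fun v => (hradp v).trans (h𝔫₁p𝔫₁ v)
  have hrad₁' : ∀ v, exp (-eL v) ≤ idealRadius K v 𝔫₁' := fun v =>
    (hradA v).trans (idealRadius_mul_le_right v h𝔫₁p0 h𝔫₁')
  -- (2) the places and the first level
  set L : List (HeightOneSpectrum (𝓞 K)) := S.toList with hL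
  have hnd : L.Nodup := Finset.nodup_toList S
  have hLS : ∀ v, v ∈ L ↔ v ∈ S := fun v => Finset.mem_toList
  set k : HeightOneSpectrum (𝓞 K) → ℕ := fun v => spreadK (n + 1) (c v) (eL v) with hk
  set 𝔫L : Ideal (𝓞 K) := spreadLevelIdeal 𝔫₁ k L with h𝔫Ldef
  have h𝔫L : 𝔫L ≠ 0 := spreadLevelIdeal_ne_zero h𝔫₁ k L
  -- (3) the spread intertwiner `T_sp = E_L T₁`
  obtain ⟨TL, hTL, hTLeq⟩ := exists_spreadIter_intertwiner (W := P.1) (c := c) (e := eL) (ϖ := ϖ) h𝔫₁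
    (fun v _ => hH v) hnd hT₁
  set Tsp : multiplicityModule hcpt τ P.1 := ⟨TL, finitePrincipalCongruenceLevel (n + 1) K 𝔫L,
    isOpen_finitePrincipalCongruenceLevel (n + 1) K h𝔫L, isCompact_finitePrincipalCongruenceLevel (n + 1) K h𝔫L, hTL⟩
    with hTsp
  -- the `D_f`-translates: `D_f T_sp = E_L (D_f T₁)`
  have hDf1 : ∀ v ∈ L, localComponent v (GLn.ofFinite (n + 1) K Df) = 1 := fun v hv => by
    rw [localComponent_ofFinite, hDfS v ((hLS v).1 hv)]
  have hTLeqD : ∀ x : E, ((finComponentRep hcpt τ P.1 Df Tsp : multiplicityModule hcpt τ P.1) :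
        E →L[ℂ] (AdelicGroupData.gl (n + 1) K).L2 μ) x =
      ((spreadIter P.1 c eL ϖ L (corestrictW hDT₁lev.1 x) : P.1.toSubmodule) : (AdelicGroupData.gl (n + 1) K).L2 μ) := by
    intro x
    rw [coe_finComponentRep_apply, ContinuousLinearMap.comp_apply]
    change (AdelicGroupData.gl (n + 1) K).rightRegular μ (GLn.ofFinite (n + 1) K Df) (TL x) = _
    have h1 : corestrictW hDT₁lev.1 x = P.1.toContRep (GLn.ofFinite (n + 1) K Df) (corestrictW hT₁.1 x) := by
      apply Subtype.ext
      rw [ContRepresentation.ClosedSubrep.coe_toContRep_apply, coe_corestrictW_apply, coe_corestrictW_apply,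
        coe_finComponentRep_apply, ContinuousLinearMap.comp_apply]
    rw [hTLeq x, h1]
    have h2 := toContRep_spreadIter (W := P.1) (c := c) (e := eL) (ϖ := ϖ) (fun v _ => hH v) hDf1 (corestrictW hT₁.1 x)
    have h3 := congrArg Subtype.val h2
    rw [ContRepresentation.ClosedSubrep.coe_toContRep_apply] at h3
    exact h3
  have hΛeq : Λ₀ (finComponentRep hcpt τ P.1 Df Tsp) = Λ₀ (finComponentRep hcpt τ P.1 Df T₁) :=
    finWhittaker_spreadIter_intertwiner_eq hτ ν₀ h𝔫₁p0 (fun v _ => hH v) hnd (fun v _ => hradp v) hne hΛ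
      (finComponentRep hcpt τ P.1 Df T₁) (finComponentRep hcpt τ P.1 Df Tsp) hDT₁lev hTLeqD
  -- (4) the depth and the final level `𝔫 = (𝔫_L 𝔫₁') ∏_{v ∈ S} 𝔭_v^m`
  set m : ℕ := 1 + ∑ v ∈ S, (spreadM (c v) (eL v) + n * (spreadM (c v) (eL v) - c v)).toNat with hm
  have hmv : ∀ v ∈ S, spreadM (c v) (eL v) + n * (spreadM (c v) (eL v) - c v) ≤ m := by
    intro v hv
    have h1 : (spreadM (c v) (eL v) + n * (spreadM (c v) (eL v) - c v)).toNat ≤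
        ∑ w ∈ S, (spreadM (c w) (eL w) + n * (spreadM (c w) (eL w) - c w)).toNat :=
      Finset.single_le_sum (f := fun w => (spreadM (c w) (eL w) + n * (spreadM (c w) (eL w) - c w)).toNat)
        (fun _ _ => Nat.zero_le _) hv
    have h2 := Int.self_le_toNat (spreadM (c v) (eL v) + n * (spreadM (c v) (eL v) - c v))
    have h3 : ((∑ w ∈ S, (spreadM (c w) (eL w) + n * (spreadM (c w) (eL w) - c w)).toNat : ℕ) : ℤ) ≤ (m : ℤ) := by
      rw [hm]; exact_mod_cast Nat.le_add_left _ _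
    calc spreadM (c v) (eL v) + n * (spreadM (c v) (eL v) - c v)
        ≤ ((spreadM (c v) (eL v) + n * (spreadM (c v) (eL v) - c v)).toNat : ℤ) := h2
      _ ≤ ((∑ w ∈ S, (spreadM (c w) (eL w) + n * (spreadM (c w) (eL w) - c w)).toNat : ℕ) : ℤ) := by exact_mod_cast h1
      _ ≤ m := h3
  have hB0 : 𝔫L * 𝔫₁' ≠ 0 := mul_ne_zero h𝔫L h𝔫₁'
  set 𝔫 : Ideal (𝓞 K) := spreadLevelIdeal (𝔫L * 𝔫₁') (fun _ => m) L with h𝔫def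
  have h𝔫 : 𝔫 ≠ 0 := spreadLevelIdeal_ne_zero hB0 _ L
  have hprimes : ∀ v : HeightOneSpectrum (𝓞 K), v.asIdeal ∣ 𝔫 → v ∈ S := by
    intro v hv
    rcases mem_or_dvd_of_dvd_spreadLevelIdeal _ hv with h | h
    · rcases (Ideal.IsPrime.mul_le v.isPrime).1 (Ideal.le_of_dvd h) with h' | h'
      · rcases mem_or_dvd_of_dvd_spreadLevelIdeal k (Ideal.dvd_iff_le.2 h') with h'' | h''
        · exact hS𝔫₁ v h''
        · exact (hLS v).1 h''
      · exact hS𝔫₁' v (Ideal.dvd_iff_le.2 h')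
    · exact (hLS v).1 h
  have hradius : ∀ v ∈ S, idealRadius K v 𝔫 ≤ exp (-(m : ℤ)) := by
    intro v hv
    rw [h𝔫def, idealRadius_spreadLevelIdeal_of_mem hB0 _ hnd ((hLS v).2 hv)]
    exact mul_le_of_le_one_right' (idealRadius_le_one K v _)
  have h𝔫leL : ∀ v, idealRadius K v 𝔫 ≤ idealRadius K v 𝔫L := fun v =>
    (idealRadius_spreadLevelIdeal_le hB0 _ L v).trans (idealRadius_mul_le_left v h𝔫L h𝔫₁')
  have h𝔫le' : ∀ v, idealRadius K v 𝔫 ≤ idealRadius K v 𝔫₁' := fun v =>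
    (idealRadius_spreadLevelIdeal_le hB0 _ L v).trans (idealRadius_mul_le_right v h𝔫L h𝔫₁')
  have hKleL : finitePrincipalCongruenceLevel (n + 1) K 𝔫 ≤ finitePrincipalCongruenceLevel (n + 1) K 𝔫L :=
    finitePrincipalCongruenceLevel_le_of_idealRadius_le (n + 1) h𝔫leL
  have hKle' : finitePrincipalCongruenceLevel (n + 1) K 𝔫 ≤ finitePrincipalCongruenceLevel (n + 1) K 𝔫₁' :=
    finitePrincipalCongruenceLevel_le_of_idealRadius_le (n + 1) h𝔫le'
  have hTsplev : (Tsp : E →L[ℂ] (AdelicGroupData.gl (n + 1) K).L2 μ) ∈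
      archIntertwinersLevel hcpt τ P.1 (finitePrincipalCongruenceLevel (n + 1) K 𝔫) :=
    archIntertwinersLevel_antitone hKleL hTL
  have hT₁'lev : (T₁' : E' →L[ℂ] (AdelicGroupData.gl (n + 1) K).L2 μ) ∈
      archIntertwinersLevel hcpt τ' Q.1 (finitePrincipalCongruenceLevel (n + 1) K 𝔫) :=
    archIntertwinersLevel_antitone hKle' hT₁'
  -- (5) the two cusp forms and their invariance under `K(𝔫)`
  set u : P.1.toSubmodule := ⟨TL (e : E), apply_mem_of_mem_multiplicityModule Tsp e⟩ with hu
  set u' : Q.1.toSubmodule := ⟨(T₁' : E' →L[ℂ] (AdelicGroupData.gl (n + 1) K).L2 μ) (e' : E'),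
    apply_mem_of_mem_multiplicityModule T₁' e'⟩ with hu'
  have hfixlev : ∀ (x : E) (g : (AdelicGroupData.gl (n + 1) K).Adelic), g ∈ principalCongruenceLevel (n + 1) K 𝔫 →
      (AdelicGroupData.gl (n + 1) K).rightRegular μ g (TL x) = TL x := by
    intro x g hg
    have hg' : GLn.ofFinite (n + 1) K (GLn.sndHom (n + 1) K g) = g :=
      GLn.ofFinite_sndHom_of_mem (principalCongruenceLevel_le (n + 1) K 𝔫 hg)
    have hsnd : GLn.sndHom (n + 1) K g ∈ finitePrincipalCongruenceLevel (n + 1) K 𝔫 := by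
      rw [mem_finitePrincipalCongruenceLevel_iff, hg']; exact hg
    rw [← hg']
    exact (mem_levelPiece_iff.1 (hTsplev.2 x)).2 _ hsnd
  have hfixlev' : ∀ (x : E') (g : (AdelicGroupData.gl (n + 1) K).Adelic), g ∈ principalCongruenceLevel (n + 1) K 𝔫 →
      (AdelicGroupData.gl (n + 1) K).rightRegular μ g ((T₁' : E' →L[ℂ] (AdelicGroupData.gl (n + 1) K).L2 μ) x) =
        (T₁' : E' →L[ℂ] (AdelicGroupData.gl (n + 1) K).L2 μ) x := by
    intro x g hg
    have hg' : GLn.ofFinite (n + 1) K (GLn.sndHom (n + 1) K g) = g :=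
      GLn.ofFinite_sndHom_of_mem (principalCongruenceLevel_le (n + 1) K 𝔫 hg)
    have hsnd : GLn.sndHom (n + 1) K g ∈ finitePrincipalCongruenceLevel (n + 1) K 𝔫 := by
      rw [mem_finitePrincipalCongruenceLevel_iff, hg']; exact hg
    rw [← hg']
    exact (mem_levelPiece_iff.1 (hT₁'lev.2 x)).2 _ hsnd
  have hUu : ∀ g ∈ principalCongruenceLevel (n + 1) K 𝔫, P.1.toContRep g u = u := fun g hg =>
    Subtype.ext (by rw [ContRepresentation.ClosedSubrep.coe_toContRep_apply]; exact hfixlev (e : E) g hg)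
  have hUu' : ∀ g ∈ principalCongruenceLevel (n + 1) K 𝔫, Q.1.toContRep g u' = u' := fun g hg =>
    Subtype.ext (by rw [ContRepresentation.ClosedSubrep.coe_toContRep_apply]; exact hfixlev' (e' : E') g hg)
  -- (6) `K_∞`-finiteness of the two cusp forms
  have hfin : FiniteDimensional ℂ (Submodule.span ℂ (Set.range
      fun κ : (AutomorphyDatum.gl (n + 1) K hcpt).arch.maximalCompact =>
        P.1.toContRep ((AutomorphyDatum.gl (n + 1) K hcpt).ofK κ) u)) :=
    finiteDimensional_span_toContRep_ofK_of_mem_archIntertwiners P hTL.1 (e : E) hefin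
  have hfin' : FiniteDimensional ℂ (Submodule.span ℂ (Set.range
      fun κ : (AutomorphyDatum.gl (n + 1) K hcpt).arch.maximalCompact =>
        Q.1.toContRep ((AutomorphyDatum.gl (n + 1) K hcpt).ofK κ) u')) :=
    finiteDimensional_span_toContRep_ofK_of_mem_archIntertwiners Q hT₁'.1 (e' : E') he'fin
  -- (7) the common fixing test function (hypothesis `hcf`)
  have hUlev : principalCongruenceLevel (n + 1) K 𝔫 ∈ (AutomorphyDatum.gl (n + 1) K hcpt).finiteLevels := by
    rw [AutomorphyDatum.gl_finiteLevels]
    exact principalCongruenceLevel_mem_finiteLevelsGL_holds (n + 1) K h𝔫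
  obtain ⟨η, hη, hηK, hfix, hfix'⟩ := hcf hUlev u u' hfin hfin' hUu hUu'
  -- (8) assemble
  refine ⟨m, 𝔫, h𝔫, hprimes, Tsp, η, fun v => spreadTorus (n + 1) (ϖ v) (c v) (eL v), fun v => spreadM (c v) (eL v), c,
    hη, hηK, by omega, hradius, hΛeq, hTsplev, hT₁'lev, hfix, hfix', fun v hv h hh => ?_, fun v hv k' hk' => ?_,
    fun v hv => ?_, fun v hv => ?_⟩
  · -- isotypy of `T_sp` at `v ∈ S`
    have hv' : v ∈ L := (hLS v).2 hv
    apply Subtype.ext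
    refine ContinuousLinearMap.ext fun x => ?_
    rw [coe_finComponentRep_apply, ContinuousLinearMap.comp_apply, GLn.ofFinite_sndHom_ofLocal]
    have h := isotypic_apply_of_spreadIter_intertwiner (fun v _ => hH v) hnd hT₁.1 hTL.1 hTLeq x v hv' h hh
    have h' := congrArg Subtype.val h
    rw [ContRepresentation.ClosedSubrep.coe_toContRep_apply, coe_corestrictW_apply, Submodule.coe_smul, coe_corestrictW_apply] at h'
    rw [Submodule.coe_smul, FunLike.coe_smul, Pi.smul_apply]
    exact h'
  · -- `T₁'` is fixed by `ι_v(K(𝔭_v^{M_v}))`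
    have hM : exp (-spreadM (c v) (eL v)) ≤ exp (-eL v) := exp_le_exp.2 (neg_le_neg (le_spreadM (c v) (eL v)))
    have hk'lev : k' ∈ levelAt (n + 1) K v 𝔫₁' := valuedCongruenceSubgroup_mono _ (hM.trans (hrad₁' v)) hk'
    have hmem := sndHom_ofLocal_mem_finitePrincipalCongruenceLevel h𝔫₁' hk'lev
    exact (Representation.mem_stabilizerSubgroup _ _ _).1 (le_stabilizerSubgroup_finComponentRep hT₁' hmem)
  · -- the parameters at `v ∈ S`
    obtain ⟨x, hx, hx1⟩ := (hc v).2
    refine ⟨⟨x, ?_, hx1⟩, one_le_spreadM (hH v).e_nonneg, (hH v).hψ, valuation_spreadTorus_antitone (hH v).e_nonneg (hH v).unif,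
      valuation_spreadTorus_gap (hH v).unif, valuation_spreadTorus_depth (hH v).unif (hmv v hv)⟩
    have h1 := (mem_primePowBall_adicCompletion_iff (v := v)).1 hx
    rwa [show (-(c v - 1) : ℤ) = 1 - c v by ring] at h1
  · -- the global spread property of `W_{T_sp e}`
    have hv' : v ∈ L := (hLS v).2 hv
    have hiso : ∀ h ∈ spreadLevelGroup (spreadTorus (n + 1) (ϖ v) (c v) (eL v)) (spreadM (c v) (eL v)),
        P.1.toContRep (GLn.ofLocal (n + 1) K v h) (smoothedVector P.1 η u) = spreadChar v h • smoothedVector P.1 η u := by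
      intro h hh
      rw [hfix]
      exact isotypic_apply_of_spreadIter_intertwiner (fun v _ => hH v) hnd hT₁.1 hTL.1 hTLeq (e : E) v hv' h hh
    exact isSpreadWhittakerAt_of_isotypic ν₀ (le_trans zero_le_one (one_le_spreadM (hH v).e_nonneg)) (hH v).hψ hη u hiso

/-- **The spread pair datum for the SELF-PAIR `(π, π)` at a prescribed finite set of places.** As
`exists_spreadPairDatum_of_commonFixing` with `σ' = π`: the second intertwiner `T₁' : τ' → π` maps into
the SAME cuspidal representation, and the common fixing test function of the two `K_∞`-finite cusp forms
`T_sp e`, `T₁' e'` of `π` is supplied by `exists_testFunction_smoothedVector_eq_pairSame` (Harish-Chandra's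
finiteness theorem). This is the global realisation, at a level supported on the prescribed `S`, of an
archimedean datum of the pair `(τ, τ')` of archimedean components of `π` in the Rankin–Selberg method for
`L^S(s, π × π̃)` (Jacquet–Shalika (1981), §4; Cogdell (2004), §4.1; the bad places by
Jacquet–Piatetski-Shapiro–Shalika (1983), (2.7)).
[cite: JacquetPiatetskiShapiroShalika1983, §2 (2.7)] [cite: CogdellAnalyticTheory2004, §4.1] -/
theorem exists_spreadPairDatum_self (P : CuspidalAutomorphicRepGL (n + 1) K μ)
    (hτ : τ.IsStronglyContinuous)
    (ν₀ : Measure ↥(adelicUnipotent (n + 1) K)) [IsHaarMeasure ν₀]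
    {T₀ : multiplicityModule hcpt τ P.1} {Λ₀ : multiplicityModule hcpt τ P.1 →ₗ[ℂ] ℂ}
    (hne : transferMap (whittakerFunctional ν₀ (continuous_adeleAddChar K)
      (ContRepresentation.Equiv.refl P.1.toContRep)) hτ T₀ ≠ 0)
    (hΛ : ∀ T : multiplicityModule hcpt τ P.1,
      transferMap (whittakerFunctional ν₀ (continuous_adeleAddChar K)
        (ContRepresentation.Equiv.refl P.1.toContRep)) hτ T =
        Λ₀ T • transferMap (whittakerFunctional ν₀ (continuous_adeleAddChar K)
          (ContRepresentation.Equiv.refl P.1.toContRep)) hτ T₀)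
    (S : Finset (HeightOneSpectrum (𝓞 K)))
    {𝔫₁ : Ideal (𝓞 K)} (h𝔫₁ : 𝔫₁ ≠ 0) (hS𝔫₁ : ∀ v : HeightOneSpectrum (𝓞 K), v.asIdeal ∣ 𝔫₁ → v ∈ S)
    (T₁ : multiplicityModule hcpt τ P.1)
    (hT₁ : (T₁ : E →L[ℂ] (AdelicGroupData.gl (n + 1) K).L2 μ) ∈
      archIntertwinersLevel hcpt τ P.1 (finitePrincipalCongruenceLevel (n + 1) K 𝔫₁))
    {𝔫₁' : Ideal (𝓞 K)} (h𝔫₁' : 𝔫₁' ≠ 0) (hS𝔫₁' : ∀ v : HeightOneSpectrum (𝓞 K), v.asIdeal ∣ 𝔫₁' → v ∈ S)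
    (T₁' : multiplicityModule hcpt τ' P.1)
    (hT₁' : (T₁' : E' →L[ℂ] (AdelicGroupData.gl (n + 1) K).L2 μ) ∈
      archIntertwinersLevel hcpt τ' P.1 (finitePrincipalCongruenceLevel (n + 1) K 𝔫₁'))
    (Df : GL (Fin (n + 1)) (FiniteAdeleRing (𝓞 K) K))
    (hDfS : ∀ v ∈ S, BigHeckeGLn.localComponent (n + 1) K v Df = 1)
    (Splus : Finset (HeightOneSpectrum (𝓞 K)))
    (hDfint : ∀ w ∉ Splus, BigHeckeGLn.localComponent (n + 1) K w Df ∈ valuedCongruenceSubgroup (Fin (n + 1)) (1 : ℤᵐ⁰))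
    (e : archGardingSpace hcpt τ) (e' : archGardingSpace hcpt τ')
    (hefin : FiniteDimensional ℂ (Submodule.span ℂ (Set.range
      fun κ : (AutomorphyDatum.gl (n + 1) K hcpt).arch.maximalCompact =>
        τ (toArch hcpt (κ : GL (Fin (n + 1)) (mixedSpace K))) (e : E))))
    (he'fin : FiniteDimensional ℂ (Submodule.span ℂ (Set.range
      fun κ : (AutomorphyDatum.gl (n + 1) K hcpt).arch.maximalCompact =>
        τ' (toArch hcpt (κ : GL (Fin (n + 1)) (mixedSpace K))) (e' : E')))) :
    ∃ (m : ℕ) (𝔫 : Ideal (𝓞 K)) (_ : 𝔫 ≠ 0) (_ : ∀ v : HeightOneSpectrum (𝓞 K), v.asIdeal ∣ 𝔫 → v ∈ S)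
      (Tsp : multiplicityModule hcpt τ P.1) (η : GL (Fin (n + 1)) (AdeleRing (𝓞 K) K) → ℝ)
      (t : ∀ v : HeightOneSpectrum (𝓞 K), Fin (n + 1) → (v.adicCompletion K)ˣ) (M c₀ : HeightOneSpectrum (𝓞 K) → ℤ),
      IsTestFunctionGL (n + 1) K η ∧
      (∀ k : (AdelicGroupData.gl (n + 1) K).Adelic, k ∈ principalCongruenceLevel (n + 1) K 𝔫 →
        ∀ g : (AdelicGroupData.gl (n + 1) K).Adelic, η (k * g) = η g) ∧
      1 ≤ m ∧ (∀ v ∈ S, idealRadius K v 𝔫 ≤ exp (-(m : ℤ))) ∧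
      Λ₀ (finComponentRep hcpt τ P.1 Df Tsp) = Λ₀ (finComponentRep hcpt τ P.1 Df T₁) ∧
      (Tsp : E →L[ℂ] (AdelicGroupData.gl (n + 1) K).L2 μ) ∈
        archIntertwinersLevel hcpt τ P.1 (finitePrincipalCongruenceLevel (n + 1) K 𝔫) ∧
      (T₁' : E' →L[ℂ] (AdelicGroupData.gl (n + 1) K).L2 μ) ∈
        archIntertwinersLevel hcpt τ' P.1 (finitePrincipalCongruenceLevel (n + 1) K 𝔫) ∧
      smoothedVector P.1 η ⟨(Tsp : E →L[ℂ] (AdelicGroupData.gl (n + 1) K).L2 μ) (e : E),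
          apply_mem_of_mem_multiplicityModule Tsp e⟩ =
        ⟨(Tsp : E →L[ℂ] (AdelicGroupData.gl (n + 1) K).L2 μ) (e : E), apply_mem_of_mem_multiplicityModule Tsp e⟩ ∧
      smoothedVector P.1 η ⟨(T₁' : E' →L[ℂ] (AdelicGroupData.gl (n + 1) K).L2 μ) (e' : E'),
          apply_mem_of_mem_multiplicityModule T₁' e'⟩ =
        ⟨(T₁' : E' →L[ℂ] (AdelicGroupData.gl (n + 1) K).L2 μ) (e' : E'), apply_mem_of_mem_multiplicityModule T₁' e'⟩ ∧
      (∀ v ∈ S, ∀ h ∈ spreadLevelGroup (t v) (M v),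
        finComponentRep hcpt τ P.1 (GLn.sndHom (n + 1) K (GLn.ofLocal (n + 1) K v h)) Tsp = spreadChar v h • Tsp) ∧
      (∀ v ∈ S, ∀ k ∈ valuedCongruenceSubgroup (Fin (n + 1)) (exp (-M v)),
        finComponentRep hcpt τ' P.1 (GLn.sndHom (n + 1) K (GLn.ofLocal (n + 1) K v k)) T₁' = T₁') ∧
      (∀ v ∈ S, (∃ x : v.adicCompletion K, Valued.v x ≤ exp (1 - c₀ v) ∧ (adeleAddChar K).adicComponent v x ≠ 1) ∧
        1 ≤ M v ∧
        (∀ i j : Fin (n + 1), (i : ℕ) + 1 = j → ∀ x : v.adicCompletion K, Valued.v x ≤ exp (-M v) →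
          (adeleAddChar K).adicComponent v ((t v i : v.adicCompletion K) * (t v j : v.adicCompletion K)⁻¹ * x) = 1) ∧
        (∀ i j : Fin (n + 1), i ≤ j → Valued.v (t v j : v.adicCompletion K) ≤ Valued.v (t v i : v.adicCompletion K)) ∧
        (∀ i j : Fin (n + 1), (i : ℕ) + 1 = j →
          exp (M v - c₀ v) * Valued.v (t v j : v.adicCompletion K) ≤ Valued.v (t v i : v.adicCompletion K)) ∧
        exp (-(m : ℤ)) * Valued.v (t v 0 : v.adicCompletion K) ≤
          exp (-M v) * Valued.v (t v (Fin.last n) : v.adicCompletion K)) ∧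
      ∀ v ∈ S, IsSpreadWhittakerAt v (adeleAddChar K) (t v) (M v)
        (whittakerCoeff ν₀ (unipotentTateDomain (n + 1) K) (adeleAddChar K)
          (invQuot (AdelicGroupData.gl (n + 1) K)
            (smoothedForm η ((Tsp : E →L[ℂ] (AdelicGroupData.gl (n + 1) K).L2 μ) (e : E))))) :=
  exists_spreadPairDatum_of_commonFixing P P
    (fun hU u u' hfin hfin' hUu hUu' => exists_testFunction_smoothedVector_eq_pairSame hcpt P hU u u' hfin hfin' hUu hUu')
    hτ ν₀ hne hΛ S h𝔫₁ hS𝔫₁ T₁ hT₁ h𝔫₁' hS𝔫₁' T₁' hT₁' Df hDfS Splus hDfint e e' hefin he'fin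

end Datum

end Literature.NumberTheory.Automorphic
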